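import Summits.RiemannHypothesis.RiemannHypothesis.Theorems.PfPersistenceAffineMatching
import HarnessLib

/-!
# PF persistence — the FIBREWISE CO-CONVEX BARRIER (pub-rhpf, cand-6 gen 3; part 2 of 2)

**HONEST FRAMING. MECHANISM / RIGIDITY campaign; no RH claims.**  RH-free statements about WHICH criteria
can separate `ζ`'s datum from detectably negative ARITHMETIC tables; nothing here bears on whether `ζ` is
window-positive; no DATA enters.

**The class (one class containing the three kernel barriers of record).**  Fix finitely many FREE WINDOWS
`W` and finitely many AFFINE COORDINATES `Φ : Datum →ₗ[ℝ] (ι → ℝ)` (`ι` finite; read at ANY windows).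
`S ⊆ Datum` is FIBREWISE CO-CONVEX if for any two data with the same matrices on `W` and the same `Φ`,
both REJECTED, every convex combination is rejected.  Members: every `S` DETERMINED by `(d|_W, Φ d)` —
any functional whatsoever of finitely many windows (T-W1, `FinitelyDetermined`) together with any
predicate / tolerance / value type of finitely many affine statistics across all windows (trace and
fixed-test TRANSPORT LAWS `|X(a′) − X(a)| ≤ tol`, ratio bands, kink residuals of affine readings,
`Σ_win c_win Tr(A_win · d win)`) — `windowsAffine_meets_arithDialNegativesNe`; every CO-CONVEX `S`
(B-CVX-DATUM, OR-families of affine acceptances) now on the ARITHMETIC domain —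
`coconvex_meets_arithDialNegativesNe` (RULING A53 (a)); ONE co-convex criterion AND any determined one —
`coconvex_inter_determined_meets_arithDialNegativesNe`.  Not members: AND-families of affine tests (convex
acceptance — the sound shape, `convex_positiveClass`), `ε₁`-readers at infinitely many windows.

**The theorem (PROVED)** `fibrewiseCoconvex_meets_arithDialNegativesNe`: such an `S` containing `ζ`'s
datum contains the datum of an ARITHMETIC table `≠ ζ`, detectably negative at a genuine window — by the
matching lemma of part 1, `ζ` is a convex combination of two detectably negative fibre-mates, so one of
them is accepted.
-/

set_option linter.dupNamespace false

noncomputable section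

open Matrix Finset

namespace Summit.RiemannHypothesis.RiemannHypothesis.Theorems.PfPersistence

/-! ## §4 THE FIBREWISE CO-CONVEX BARRIER and its named members (PROVED, RH-free) -/

/-- **PROVED — THE FIBREWISE CO-CONVEX BARRIER.**  If rejection by `S` is convex WITHIN every joint fibre
of (the matrices on the finitely many windows `W`, the finitely many affine coordinates `Φ`), and `S`
contains `ζ`'s datum, then `S` contains the datum of an ARITHMETIC table `≠ ζ` that is detectably negative
at a genuine window. [folklore] -/
theorem fibrewiseCoconvex_meets_arithDialNegativesNe {ι : Type*} [Fintype ι] (Φ : Datum →ₗ[ℝ] (ι → ℝ))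
    (W : Finset Window) {S : Set Datum}
    (hS : ∀ d₁ d₂ : Datum, Φ d₁ = Φ d₂ → (∀ win ∈ W, d₁ win = d₂ win) → d₁ ∉ S → d₂ ∉ S →
      ∀ s t : ℝ, 0 ≤ s → 0 ≤ t → s + t = 1 → s • d₁ + t • d₂ ∉ S)
    (hζ : zetaDatum ∈ S) : ∃ d ∈ arithDialSpace, d ≠ zetaDatum ∧ d ∈ S ∧ DetectablyNegative d := by
  obtain ⟨v, t₁, t₂, ht, harith, hΦ, hW, hne₁, hneg₁, hne₂, hneg₂⟩ := exists_arith_twoSided_matching Φ W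
  by_cases h₁ : datumOf (zetaWeights + t₁ • v) ∈ S
  · exact ⟨_, ⟨_, harith t₁, rfl⟩, hne₁, h₁, hneg₁⟩
  by_cases h₂ : datumOf (zetaWeights + t₂ • v) ∈ S
  · exact ⟨_, ⟨_, harith t₂, rfl⟩, hne₂, h₂, hneg₂⟩
  exfalso
  obtain ⟨s, t, hs, ht', hst, hcombo⟩ := convexCombo_zero_of_mul_neg ht
  have htab : s • (zetaWeights + t₁ • v) + t • (zetaWeights + t₂ • v) = zetaWeights := by
    rw [smul_add, smul_add, smul_smul, smul_smul, add_add_add_comm, ← add_smul, ← add_smul, hst, hcombo,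
      one_smul, zero_smul, add_zero]
  have hζeq : s • datumOf (zetaWeights + t₁ • v) + t • datumOf (zetaWeights + t₂ • v) = zetaDatum := by
    rw [← datumOf_convexCombo _ _ hst, htab]
    rfl
  have := hS _ _ (by rw [hΦ, hΦ]) (fun win hwin => by rw [hW t₁ win hwin, hW t₂ win hwin]) h₁ h₂
    s t hs ht' hst
  rw [hζeq] at this
  exact this hζ

/-- PROVED (member: DETERMINED criteria).  Membership depending on the datum only through its matrices at
finitely many windows `W` (ANY functional there) AND finitely many affine coordinates `Φ` at ANY windows:
`W = ∅` is pure finite affine rank; `Φ = 0` is the locality barrier T-W1 (not restated). [folklore] -/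
theorem windowsAffine_meets_arithDialNegativesNe {ι : Type*} [Fintype ι] (Φ : Datum →ₗ[ℝ] (ι → ℝ))
    (W : Finset Window) {S : Set Datum}
    (hS : ∀ d d' : Datum, (∀ win ∈ W, d win = d' win) → Φ d = Φ d' → (d ∈ S ↔ d' ∈ S))
    (hζ : zetaDatum ∈ S) : ∃ d ∈ arithDialSpace, d ≠ zetaDatum ∧ d ∈ S ∧ DetectablyNegative d := by
  refine fibrewiseCoconvex_meets_arithDialNegativesNe Φ W (fun d₁ d₂ hΦ hW h₁ _ s t _ _ hst hmem => ?_) hζ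
  refine h₁ ((hS _ _ (fun win hwin => ?_) ?_).1 hmem)
  · rw [Pi.add_apply, Pi.smul_apply, Pi.smul_apply, ← hW win hwin, ← add_smul, hst, one_smul]
  · rw [map_add, map_smul, map_smul, ← hΦ, ← add_smul, hst, one_smul]

/-- PROVED (`W = ∅`): a criterion factoring through finitely many affine coordinates of the datum (any value
type / tolerance / predicate of those numbers, any windows) meets the arithmetic negatives `≠ ζ`. [folklore] -/
theorem finiteAffineRank_meets_arithDialNegativesNe {ι : Type*} [Fintype ι] (Φ : Datum →ₗ[ℝ] (ι → ℝ))
    {S : Set Datum} (hS : ∀ d d' : Datum, Φ d = Φ d' → (d ∈ S ↔ d' ∈ S)) (hζ : zetaDatum ∈ S) :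
    ∃ d ∈ arithDialSpace, d ≠ zetaDatum ∧ d ∈ S ∧ DetectablyNegative d :=
  windowsAffine_meets_arithDialNegativesNe Φ ∅ (fun d d' _ h => hS d d' h) hζ

/-- PROVED (member: CO-CONVEX criteria, arithmetic domain — the corollary RULING A53 (a) asked for). [folklore] -/
theorem coconvex_meets_arithDialNegativesNe {S : Set Datum} (hconv : Convex ℝ Sᶜ) (hζ : zetaDatum ∈ S) :
    ∃ d ∈ arithDialSpace, d ≠ zetaDatum ∧ d ∈ S ∧ DetectablyNegative d :=
  fibrewiseCoconvex_meets_arithDialNegativesNe (0 : Datum →ₗ[ℝ] (Fin 0 → ℝ)) ∅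
    (fun _ _ _ _ h₁ h₂ _ _ hs ht hst => hconv h₁ h₂ hs ht hst) hζ

/-- PROVED (member: ONE co-convex criterion AND any determined criterion). [folklore] -/
theorem coconvex_inter_determined_meets_arithDialNegativesNe {ι : Type*} [Fintype ι]
    (Φ : Datum →ₗ[ℝ] (ι → ℝ)) (W : Finset Window) {S₁ S₂ : Set Datum} (hconv : Convex ℝ S₁ᶜ)
    (hS₂ : ∀ d d' : Datum, (∀ win ∈ W, d win = d' win) → Φ d = Φ d' → (d ∈ S₂ ↔ d' ∈ S₂))
    (hζ : zetaDatum ∈ S₁ ∩ S₂) :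
    ∃ d ∈ arithDialSpace, d ≠ zetaDatum ∧ d ∈ S₁ ∩ S₂ ∧ DetectablyNegative d := by
  refine fibrewiseCoconvex_meets_arithDialNegativesNe Φ W (fun d₁ d₂ hΦ hW h₁ h₂ s t hs ht hst hmem => ?_) hζ
  have hfib : ∀ e : Datum, e = d₁ ∨ e = d₂ → (s • d₁ + t • d₂ ∈ S₂ ↔ e ∈ S₂) := by
    intro e he
    refine hS₂ _ _ (fun win hwin => ?_) ?_
    · rcases he with rfl | rfl
      · rw [Pi.add_apply, Pi.smul_apply, Pi.smul_apply, ← hW win hwin, ← add_smul, hst, one_smul]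
      · rw [Pi.add_apply, Pi.smul_apply, Pi.smul_apply, hW win hwin, ← add_smul, hst, one_smul]
    · rcases he with rfl | rfl
      · rw [map_add, map_smul, map_smul, ← hΦ, ← add_smul, hst, one_smul]
      · rw [map_add, map_smul, map_smul, hΦ, ← add_smul, hst, one_smul]
  by_cases k₁ : d₁ ∈ S₂
  · by_cases k₂ : d₂ ∈ S₂
    · exact hconv (fun h => h₁ ⟨h, k₁⟩) (fun h => h₂ ⟨h, k₂⟩) hs ht hst hmem.1
    · exact k₂ ((hfib d₂ (Or.inr rfl)).1 hmem.2)
  · exact k₁ ((hfib d₁ (Or.inl rfl)).1 hmem.2)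

/-- PROVED: no fibrewise co-convex criterion separates `ζ` from the negatives of any `D ⊇ arithDialSpace`. [folklore] -/
theorem not_separates_of_fibrewiseCoconvex {ι : Type*} [Fintype ι] (Φ : Datum →ₗ[ℝ] (ι → ℝ))
    (W : Finset Window) {S D : Set Datum} (hD : arithDialSpace ⊆ D)
    (hS : ∀ d₁ d₂ : Datum, Φ d₁ = Φ d₂ → (∀ win ∈ W, d₁ win = d₂ win) → d₁ ∉ S → d₂ ∉ S →
      ∀ s t : ℝ, 0 ≤ s → 0 ≤ t → s + t = 1 → s • d₁ + t • d₂ ∉ S) :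
    ¬ Separates S D zetaDatum := by
  rintro ⟨hζ, hsep⟩
  obtain ⟨d, hdD, -, hdS, hd⟩ := fibrewiseCoconvex_meets_arithDialNegativesNe Φ W hS hζ
  exact hsep d (hD hdD) hd hdS

/-- PROVED: no determined-by-`(W, Φ)` criterion separates `ζ` from the negatives of any `D ⊇ arithDialSpace`. [folklore] -/
theorem not_separates_of_windowsAffine {ι : Type*} [Fintype ι] (Φ : Datum →ₗ[ℝ] (ι → ℝ))
    (W : Finset Window) {S D : Set Datum} (hD : arithDialSpace ⊆ D)
    (hS : ∀ d d' : Datum, (∀ win ∈ W, d win = d' win) → Φ d = Φ d' → (d ∈ S ↔ d' ∈ S)) :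
    ¬ Separates S D zetaDatum := by
  rintro ⟨hζ, hsep⟩
  obtain ⟨d, hdD, -, hdS, hd⟩ := windowsAffine_meets_arithDialNegativesNe Φ W hS hζ
  exact hsep d (hD hdD) hd hdS

/-- PROVED: no co-convex criterion separates `ζ` from the negatives of any `D ⊇ arithDialSpace`. [folklore] -/
theorem not_separates_of_coconvex_arith {S D : Set Datum} (hD : arithDialSpace ⊆ D)
    (hconv : Convex ℝ Sᶜ) : ¬ Separates S D zetaDatum := by
  rintro ⟨hζ, hsep⟩
  obtain ⟨d, hdD, -, hdS, hd⟩ := coconvex_meets_arithDialNegativesNe hconv hζ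
  exact hsep d (hD hdD) hd hdS

/-- PROVED (family form): a criterion determined by finitely many windows and finitely many real-linear
FUNCTIONALS of the datum (traces against fixed matrices, fixed-test Rayleigh values, their sums / differences
ACROSS windows) meets the arithmetic negatives `≠ ζ` once it contains `ζ`. [folklore] -/
theorem finitelyManyFunctionals_meets_arithDialNegativesNe {ι : Type*} [Fintype ι]
    (φ : ι → (Datum →ₗ[ℝ] ℝ)) (W : Finset Window) {S : Set Datum}
    (hS : ∀ d d' : Datum, (∀ win ∈ W, d win = d' win) → (∀ i, φ i d = φ i d') → (d ∈ S ↔ d' ∈ S))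
    (hζ : zetaDatum ∈ S) : ∃ d ∈ arithDialSpace, d ≠ zetaDatum ∧ d ∈ S ∧ DetectablyNegative d :=
  windowsAffine_meets_arithDialNegativesNe (LinearMap.pi φ) W
    (fun d d' hW h => hS d d' hW fun i => by simpa using congrFun h i) hζ

/-- PROVED (instance: TRANSPORT LAW WITH TOLERANCE of an affine statistic across two windows — ANY predicate
`T` on the pair of readings — holding at `ζ` holds at an arithmetic detectably negative table `≠ ζ`). [folklore] -/
theorem affineTransport_meets_arithDialNegativesNe (φ₁ φ₂ : Datum →ₗ[ℝ] ℝ) (T : ℝ → ℝ → Prop)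
    (hζ : T (φ₁ zetaDatum) (φ₂ zetaDatum)) :
    ∃ d ∈ arithDialSpace, d ≠ zetaDatum ∧ T (φ₁ d) (φ₂ d) ∧ DetectablyNegative d := by
  have h := finitelyManyFunctionals_meets_arithDialNegativesNe (S := {d | T (φ₁ d) (φ₂ d)})
    (fun b : Bool => if b then φ₁ else φ₂) ∅ (fun d d' _ hdd' => ?_) hζ
  · simpa using h
  · have h₁ := hdd' true
    have h₂ := hdd' false
    simp only [if_true] at h₁
    simp only [Bool.false_eq_true, if_false] at h₂
    simp only [Set.mem_setOf_eq, h₁, h₂]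

end Summit.RiemannHypothesis.RiemannHypothesis.Theorems.PfPersistence

end
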